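import Mathlib
import HarnessLib
import Literature.MathematicalPhysics.StatisticalMechanics.TorusDiscreteLeibniz
import Literature.MathematicalPhysics.StatisticalMechanics.TorusNeighbourhoods

/-!
# Smooth lattice cutoffs on the torus by iterated box averaging (the cutoff `χ_X` of
# Adams–Buchholz–Kotecký–Müller, proof of Lemma 7.7 (i), (7.73))

The trace bound of [ABKM19] Lemma 7.7 (i) uses, for a `k`-polymer `X`, a cutoff `χ_X : T_N → ℝ`
with `χ_X = 1` on `X^{++}`, support in `X^{+++}`, and the smoothness estimate
`|∇^l χ_X| ≤ Θ L^{−lk}` for `l ≤ 2M`, "where `Θ` does not depend on `L` or `X`" ((7.73)); its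
existence is asserted there without construction.  This file CONSTRUCTS such cutoffs on `(ℤ/M)^d`
for an arbitrary set `S`: average the indicator of a thickening of `S` over backward boxes of
width `b` in each direction, `m` times per direction.  Each box average contracts the sup norm
and commutes with all differences, and ONE difference of ONE box average telescopes to
`b⁻¹(f(· + e_i) − f(· + e_i − b e_i))`, so every difference of order `γ` (`γ_i ≤ m`) costs
`(2/b)^{|γ|}`:

* `boxAvg b i f` and its properties (`abs_boxAvg_le`, `boxAvg_nonneg`, `fwdDiff_comm_boxAvg`,
  `iterDiff_boxAvg`, `fwdDiff_boxAvg` (telescoping));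
* `SmoothBnd κ b c f` (`|∇^γ f| ≤ c(2/b)^{|γ|}` for `γ ≤ κ`) and `SmoothBnd.boxAvg` (one box
  average raises the budget `κ` by `e_i`);
* `smooth m b f` (all directions, `m` times) with **`abs_iterDiff_smooth_le`**;
* plateau and support: `smooth_eq_of_ball` (the value at `x` is `v` if `f = v` on the ball of
  radius `d·m·(b−1)` about `x`);
* **`cutoff m b S`** `= smooth m b 1_{S + [−ρ,ρ]^d}`, `ρ = d·m·(b−1)`: `cutoff_eq_one` on `S`,
  `cutoff_eq_zero` off `S + [−2ρ,2ρ]^d`, `abs_iterDiff_cutoff_le` (`≤ (2/b)^{|γ|}`),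
  `cutoff_nonneg`, `cutoff_le_one`.

Everything is proved; no named fact.

## References
* S. Adams, S. Buchholz, R. Kotecký, S. Müller, arXiv:1910.13564, Lemma 7.7 (i), (7.73)
  [AdamsBuchholzKoteckyMuller2019].
-/

noncomputable section

namespace Literature.MathematicalPhysics.StatisticalMechanics.GradientRG

open Finset
open Literature.MathematicalPhysics.StatisticalMechanics.GradientFRD (iterDiff)
open Literature.MathematicalPhysics.StatisticalMechanics.TorusPolymer
  (ball thicken mem_ball mem_thicken thicken_thicken)

variable {d M : ℕ}

/-! ## Box averages -/

/-- **Backward box average** of width `b` in direction `i`: `(b⁻¹) Σ_{j<b} f(x − j e_i)`.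
[cite: AdamsBuchholzKoteckyMuller2019, Lemma 7.7 (i) (7.73)] -/
def boxAvg (b : ℕ) (i : Fin d) (f : (Fin d → ZMod M) → ℝ) : (Fin d → ZMod M) → ℝ :=
  fun x => (b : ℝ)⁻¹ * ∑ j ∈ Finset.range b, f (x - (j : ZMod M) • Pi.single i 1)

/-- A box average of a function bounded by `c` is bounded by `c`.
[cite: AdamsBuchholzKoteckyMuller2019, Lemma 7.7 (i) (7.73)] -/
theorem abs_boxAvg_le {b : ℕ} {i : Fin d} {f : (Fin d → ZMod M) → ℝ} {c : ℝ}
    (hf : ∀ y, |f y| ≤ c) (x : Fin d → ZMod M) : |boxAvg b i f x| ≤ c := by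
  have hc : 0 ≤ c := (abs_nonneg _).trans (hf x)
  unfold boxAvg
  rcases Nat.eq_zero_or_pos b with hb | hb
  · subst hb; simpa using hc
  rw [abs_mul, abs_inv, Nat.abs_cast]
  calc (b : ℝ)⁻¹ * |∑ j ∈ Finset.range b, f (x - (j : ZMod M) • Pi.single i 1)|
      ≤ (b : ℝ)⁻¹ * ∑ j ∈ Finset.range b, |f (x - (j : ZMod M) • Pi.single i 1)| :=
        mul_le_mul_of_nonneg_left (Finset.abs_sum_le_sum_abs _ _) (by positivity)
    _ ≤ (b : ℝ)⁻¹ * ∑ _j ∈ Finset.range b, c :=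
        mul_le_mul_of_nonneg_left (Finset.sum_le_sum fun j _ => hf _) (by positivity)
    _ = c := by
        rw [Finset.sum_const, Finset.card_range, nsmul_eq_mul, ← mul_assoc,
          inv_mul_cancel₀ (by exact_mod_cast hb.ne'), one_mul]

/-- Box averages preserve non-negativity. [cite: AdamsBuchholzKoteckyMuller2019, Lemma 7.7 (i) (7.73)] -/
theorem boxAvg_nonneg {b : ℕ} {i : Fin d} {f : (Fin d → ZMod M) → ℝ} (hf : ∀ y, 0 ≤ f y)
    (x : Fin d → ZMod M) : 0 ≤ boxAvg b i f x :=
  mul_nonneg (by positivity) (Finset.sum_nonneg fun j _ => hf _)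

/-- Box averages commute with all differences (linearity and translation invariance).
[cite: AdamsBuchholzKoteckyMuller2019, Lemma 7.7 (i) (7.73)] -/
theorem fwdDiff_comm_boxAvg (j i : Fin d) (b : ℕ) (f : (Fin d → ZMod M) → ℝ) :
    GradientFRD.fwdDiff j (boxAvg b i f) = boxAvg b i (GradientFRD.fwdDiff j f) := by
  funext x
  simp only [GradientFRD.fwdDiff, boxAvg, ← mul_sub, ← Finset.sum_sub_distrib]
  congr 1
  refine Finset.sum_congr rfl fun k _ => ?_
  rw [add_sub_right_comm]

/-- `∇^β` commutes with box averages. [cite: AdamsBuchholzKoteckyMuller2019, Lemma 7.7 (i) (7.73)] -/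
theorem iterDiff_boxAvg (β : Fin d → ℕ) (b : ℕ) (i : Fin d) (f : (Fin d → ZMod M) → ℝ) :
    iterDiff β (boxAvg b i f) = boxAvg b i (iterDiff β f) := by
  have key : ∀ l : List (Fin d), ∀ g : (Fin d → ZMod M) → ℝ,
      l.foldr (fun j g => (GradientFRD.fwdDiff j)^[β j] g) (boxAvg b i g) =
        boxAvg b i (l.foldr (fun j g => (GradientFRD.fwdDiff j)^[β j] g) g) := by
    intro l
    induction l with
    | nil => intro g; rfl
    | cons j l ih =>
      intro g
      simp only [List.foldr_cons]
      rw [ih]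
      exact Function.Commute.iterate_left (fun g => fwdDiff_comm_boxAvg j i b g) (β j) _
  exact key (List.finRange d) f

/-- **Telescoping**: one difference of one box average in the same direction,
`∇_i(boxAvg_i f)(x) = b⁻¹ (f(x + e_i) − f(x + e_i − b e_i))`.
[cite: AdamsBuchholzKoteckyMuller2019, Lemma 7.7 (i) (7.73)] -/
theorem fwdDiff_boxAvg (b : ℕ) (i : Fin d) (f : (Fin d → ZMod M) → ℝ) (x : Fin d → ZMod M) :
    GradientFRD.fwdDiff i (boxAvg b i f) x =
      (b : ℝ)⁻¹ * (f (x + Pi.single i 1) - f (x + Pi.single i 1 - (b : ZMod M) • Pi.single i 1)) := by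
  simp only [GradientFRD.fwdDiff, boxAvg, ← mul_sub, ← Finset.sum_sub_distrib]
  congr 1
  -- `Σ_{j<b} (g j − g (j+1))` with `g j = f(x + e_i − j e_i)`
  have h := Finset.sum_range_sub' (fun j : ℕ => f (x + Pi.single i 1 - (j : ZMod M) • Pi.single i 1)) b
  simp only [Nat.cast_zero, zero_smul, sub_zero] at h
  rw [← h]
  refine Finset.sum_congr rfl fun j _ => ?_
  congr 2
  simp only [Nat.cast_succ, add_smul, one_smul]
  abel

/-! ## Derivative bounds with a componentwise budget -/

/-- **`|∇^γ f| ≤ c·(2/b)^{|γ|}` for all `γ ≤ κ`** (componentwise budget `κ`).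
[cite: AdamsBuchholzKoteckyMuller2019, Lemma 7.7 (i) (7.73)] -/
def SmoothBnd (κ : Fin d → ℕ) (b : ℕ) (c : ℝ) (f : (Fin d → ZMod M) → ℝ) : Prop :=
  ∀ γ : Fin d → ℕ, (∀ i, γ i ≤ κ i) → ∀ x, |iterDiff γ f x| ≤ c * (2 / (b : ℝ)) ^ (∑ i, γ i)

/-- Budget `0`: just a sup bound. [cite: AdamsBuchholzKoteckyMuller2019, Lemma 7.7 (i) (7.73)] -/
theorem smoothBnd_zero {b : ℕ} {c : ℝ} {f : (Fin d → ZMod M) → ℝ} (hf : ∀ y, |f y| ≤ c) :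
    SmoothBnd 0 b c f := by
  intro γ hγ x
  have hγ0 : γ = 0 := funext fun i => Nat.le_zero.1 (hγ i)
  subst hγ0
  simpa using hf x

/-- **One box average in direction `i` raises the budget by `e_i`.**
[cite: AdamsBuchholzKoteckyMuller2019, Lemma 7.7 (i) (7.73)] -/
theorem SmoothBnd.boxAvg {κ : Fin d → ℕ} {b : ℕ} (hb : 1 ≤ b) {c : ℝ} {f : (Fin d → ZMod M) → ℝ}
    (h : SmoothBnd κ b c f) (i : Fin d) : SmoothBnd (κ + Pi.single i 1) b c (boxAvg b i f) := by
  intro γ hγ x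
  by_cases hγi : γ i ≤ κ i
  · -- `γ ≤ κ`: commute and contract
    have hγκ : ∀ j, γ j ≤ κ j := fun j => by
      by_cases hj : j = i
      · rw [hj]; exact hγi
      · have := hγ j; rwa [Pi.add_apply, Pi.single_eq_of_ne hj, add_zero] at this
    rw [iterDiff_boxAvg]
    exact abs_boxAvg_le (fun y => h γ hγκ y) x
  · -- `γ_i = κ_i + 1`: peel off one `∇_i` and telescope
    have hγi' : γ i = κ i + 1 := by
      have := hγ i; rw [Pi.add_apply, Pi.single_eq_same] at this; omega
    obtain ⟨γ', hγ'⟩ : ∃ γ' : Fin d → ℕ, γ = γ' + Pi.single i 1 :=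
      ⟨γ - Pi.single i 1, funext fun j => by
        by_cases hj : j = i
        · subst hj; simp; omega
        · simp [Pi.single_eq_of_ne hj]⟩
    have hγ'κ : ∀ j, γ' j ≤ κ j := fun j => by
      have := hγ j
      rw [hγ'] at this
      by_cases hj : j = i
      · subst hj; simp only [Pi.add_apply, Pi.single_eq_same] at this; omega
      · simp only [Pi.add_apply, Pi.single_eq_of_ne hj] at this; omega
    rw [hγ', ← iterDiff_fwdDiff, sum_add_single]
    -- `∇_i boxAvg_i f = b⁻¹ (shift f − shift' f)`
    have hfd : GradientFRD.fwdDiff i (GradientRG.boxAvg b i f) =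
        (b : ℝ)⁻¹ • (shiftFn (Pi.single i 1) f +
          (-1 : ℝ) • shiftFn (Pi.single i 1 - (b : ZMod M) • Pi.single i 1) f) := by
      funext y
      rw [fwdDiff_boxAvg]
      simp only [Pi.smul_apply, Pi.add_apply, shiftFn_apply, smul_eq_mul, neg_one_mul]
      rw [← add_sub_assoc]; ring
    rw [hfd, iterDiff_smul, iterDiff_add, iterDiff_smul, iterDiff_shiftFn, iterDiff_shiftFn]
    simp only [Pi.smul_apply, Pi.add_apply, shiftFn_apply, smul_eq_mul, neg_one_mul]
    have h1 := h γ' hγ'κ (x + Pi.single i 1)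
    have h2 := h γ' hγ'κ (x + (Pi.single i 1 - (b : ZMod M) • Pi.single i 1))
    have hb0 : (0 : ℝ) < b := by exact_mod_cast hb
    rw [abs_mul, abs_inv, Nat.abs_cast, pow_succ]
    calc (b : ℝ)⁻¹ * |iterDiff γ' f (x + Pi.single i 1) +
          -iterDiff γ' f (x + (Pi.single i 1 - (b : ZMod M) • Pi.single i 1))|
        ≤ (b : ℝ)⁻¹ * (c * (2 / b) ^ (∑ i, γ' i) + c * (2 / b) ^ (∑ i, γ' i)) := by
          refine mul_le_mul_of_nonneg_left ((abs_add_le _ _).trans (add_le_add h1 ?_)) (by positivity)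
          rwa [abs_neg]
      _ = c * ((2 / b) ^ (∑ i, γ' i) * (2 / b)) := by field_simp; ring

/-- Iterating the box average `m` times in direction `i` raises the budget by `m e_i`.
[cite: AdamsBuchholzKoteckyMuller2019, Lemma 7.7 (i) (7.73)] -/
theorem SmoothBnd.iterate_boxAvg {κ : Fin d → ℕ} {b : ℕ} (hb : 1 ≤ b) {c : ℝ}
    {f : (Fin d → ZMod M) → ℝ} (h : SmoothBnd κ b c f) (i : Fin d) (m : ℕ) :
    SmoothBnd (κ + Pi.single i m) b c ((GradientRG.boxAvg b i)^[m] f) := by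
  induction m with
  | zero => simpa using h
  | succ m ih =>
    rw [Function.iterate_succ_apply']
    have := ih.boxAvg hb i
    convert this using 1
    funext j
    by_cases hj : j = i
    · subst hj; simp [add_assoc]
    · simp [Pi.single_eq_of_ne hj]

/-! ## The smoothing operator -/

/-- **Smoothing**: `m` box averages of width `b` in every direction.
[cite: AdamsBuchholzKoteckyMuller2019, Lemma 7.7 (i) (7.73)] -/
def smooth (m b : ℕ) (f : (Fin d → ZMod M) → ℝ) : (Fin d → ZMod M) → ℝ :=
  (List.finRange d).foldr (fun i g => (GradientRG.boxAvg b i)^[m] g) f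

/-- The fold raises the budget by `m` in every direction processed (plumbing). [folklore] -/
private theorem smoothBnd_foldr {b : ℕ} (hb : 1 ≤ b) {c : ℝ} (m : ℕ) :
    ∀ (l : List (Fin d)), l.Nodup → ∀ {f : (Fin d → ZMod M) → ℝ}, SmoothBnd 0 b c f →
      SmoothBnd (fun i => if i ∈ l then m else 0) b c
        (l.foldr (fun i g => (GradientRG.boxAvg b i)^[m] g) f) := by
  intro l
  induction l with
  | nil =>
    intro _ f hf
    simp only [List.not_mem_nil, if_false, List.foldr_nil]
    exact hf
  | cons j l ih =>
    intro hl f hf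
    rw [List.nodup_cons] at hl
    rw [List.foldr_cons]
    have := (ih hl.2 hf).iterate_boxAvg hb j m
    convert this using 1
    funext i
    by_cases hi : i = j
    · subst hi; simp [hl.1]
    · simp [hi]

/-- **Derivative bounds of the smoothing**: if `|f| ≤ c` and `b ≥ 1`, then
`|∇^γ(smooth m b f)| ≤ c (2/b)^{|γ|}` for every `γ` with all `γ_i ≤ m`.
[cite: AdamsBuchholzKoteckyMuller2019, Lemma 7.7 (i) (7.73)] -/
theorem abs_iterDiff_smooth_le {b : ℕ} (hb : 1 ≤ b) {c : ℝ} {f : (Fin d → ZMod M) → ℝ}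
    (hf : ∀ y, |f y| ≤ c) (m : ℕ) {γ : Fin d → ℕ} (hγ : ∀ i, γ i ≤ m) (x : Fin d → ZMod M) :
    |iterDiff γ (smooth m b f) x| ≤ c * (2 / (b : ℝ)) ^ (∑ i, γ i) := by
  have h := smoothBnd_foldr hb m (List.finRange d) (List.nodup_finRange d) (smoothBnd_zero hf)
  exact h γ (fun i => by simpa using hγ i) x

/-- The smoothing preserves the bound `|·| ≤ c` (order `0`).
[cite: AdamsBuchholzKoteckyMuller2019, Lemma 7.7 (i) (7.73)] -/
theorem abs_smooth_le {b : ℕ} (hb : 1 ≤ b) {c : ℝ} {f : (Fin d → ZMod M) → ℝ}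
    (hf : ∀ y, |f y| ≤ c) (m : ℕ) (x : Fin d → ZMod M) : |smooth m b f x| ≤ c := by
  simpa using abs_iterDiff_smooth_le hb hf m (γ := 0) (fun _ => Nat.zero_le _) x

/-- The smoothing preserves non-negativity. [cite: AdamsBuchholzKoteckyMuller2019, Lemma 7.7 (i) (7.73)] -/
theorem smooth_nonneg {b m : ℕ} {f : (Fin d → ZMod M) → ℝ} (hf : ∀ y, 0 ≤ f y) (x : Fin d → ZMod M) :
    0 ≤ smooth m b f x := by
  have key : ∀ (l : List (Fin d)) {g : (Fin d → ZMod M) → ℝ}, (∀ y, 0 ≤ g y) →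
      ∀ y, 0 ≤ (l.foldr (fun i g => (GradientRG.boxAvg b i)^[m] g) g) y := by
    intro l
    induction l with
    | nil => intro g hg y; exact hg y
    | cons j l ih =>
      intro g hg y
      rw [List.foldr_cons]
      have hiter : ∀ n {u : (Fin d → ZMod M) → ℝ}, (∀ y, 0 ≤ u y) →
          ∀ y, 0 ≤ ((GradientRG.boxAvg b j)^[n] u) y := by
        intro n
        induction n with
        | zero => intro u hu y; exact hu y
        | succ n ihn => intro u hu y; rw [Function.iterate_succ_apply']; exact boxAvg_nonneg (ihn hu) y
      exact hiter m (ih hg) y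
  exact key (List.finRange d) hf x

/-! ## Plateau and support -/

variable [NeZero M]

/-- A multiple `j e_i` has sup-norm at most `j`. [cite: AdamsBuchholzKoteckyMuller2019, Ch. 6.2] -/
theorem supNorm_natCast_smul_single_le (j : ℕ) (i : Fin d) :
    GradientFRD.supNorm ((j : ZMod M) • (Pi.single i 1 : Fin d → ZMod M)) ≤ j := by
  rw [TorusPolymer.supNorm_le_iff]
  intro i'
  by_cases h : i' = i
  · subst h
    rw [Pi.smul_apply, Pi.single_eq_same, smul_eq_mul, mul_one]
    have := GradientFRD.natAbs_valMinAbs_intCast_le (M := M) (j : ℤ)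
    rwa [Int.cast_natCast, Int.natAbs_natCast] at this
  · rw [Pi.smul_apply, Pi.single_eq_of_ne h, smul_zero, ZMod.valMinAbs_zero]; simp

/-- **Locality of one box average**: if `g = v` at every point whose `ρ`-ball satisfies `P`,
then `boxAvg b i g = v` at every point whose `(ρ + (b−1))`-ball satisfies `P` (`b ≥ 1`).
[cite: AdamsBuchholzKoteckyMuller2019, Lemma 7.7 (i) (7.73)] -/
theorem boxAvg_eq_of_ball {b : ℕ} (hb : 1 ≤ b) {i : Fin d} {g : (Fin d → ZMod M) → ℝ} {v : ℝ}
    {P : (Fin d → ZMod M) → Prop} {ρ : ℕ} (h : ∀ x, (∀ y ∈ ball ρ x, P y) → g x = v)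
    (x : Fin d → ZMod M) (hx : ∀ y ∈ ball (ρ + (b - 1)) x, P y) : GradientRG.boxAvg b i g x = v := by
  unfold GradientRG.boxAvg
  have hterm : ∀ j ∈ Finset.range b, g (x - (j : ZMod M) • Pi.single i 1) = v := by
    intro j hj
    refine h _ fun y hy => hx y ?_
    rw [mem_ball] at hy ⊢
    have htri := TorusPolymer.supNorm_sub_le y (x - (j : ZMod M) • Pi.single i 1) x
    have hj' : GradientFRD.supNorm (x - (j : ZMod M) • Pi.single i 1 - x) ≤ b - 1 := by
      rw [show x - (j : ZMod M) • Pi.single i 1 - x = -((j : ZMod M) • (Pi.single i 1 : Fin d → ZMod M)) by abel,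
        GradientFRD.supNorm_neg]
      have := supNorm_natCast_smul_single_le (M := M) j i
      have hjb := Finset.mem_range.1 hj
      omega
    omega
  rw [Finset.sum_congr rfl hterm, Finset.sum_const, Finset.card_range, nsmul_eq_mul, ← mul_assoc,
    inv_mul_cancel₀ (by exact_mod_cast (show b ≠ 0 by omega)), one_mul]

/-- **Locality of the smoothing**: if `f = v` at every point satisfying `P`, then
`smooth m b f = v` at every point whose ball of radius `d·m·(b−1)` satisfies `P`. [cite: AdamsBuchholzKoteckyMuller2019, Lemma 7.7 (i) (7.73)] -/
theorem smooth_eq_of_ball {b : ℕ} (hb : 1 ≤ b) (m : ℕ) {f : (Fin d → ZMod M) → ℝ} {v : ℝ}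
    {P : (Fin d → ZMod M) → Prop} (h : ∀ x, P x → f x = v) (x : Fin d → ZMod M)
    (hx : ∀ y ∈ ball (d * (m * (b - 1))) x, P y) : smooth m b f x = v := by
  -- invariant along the fold: radius `(#processed directions)·m·(b−1)`
  have key : ∀ (l : List (Fin d)) (x : Fin d → ZMod M),
      (∀ y ∈ ball (l.length * (m * (b - 1))) x, P y) →
        (l.foldr (fun i g => (GradientRG.boxAvg b i)^[m] g) f) x = v := by
    intro l
    induction l with
    | nil =>
      intro x hx
      exact h x (hx x (TorusPolymer.mem_ball_self _ x))
    | cons j l ih =>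
      intro x hx
      rw [List.foldr_cons]
      -- `m` box averages in direction `j`, each adding `b − 1` to the radius
      have hiter : ∀ n (x : Fin d → ZMod M),
          (∀ y ∈ ball (l.length * (m * (b - 1)) + n * (b - 1)) x, P y) →
            ((GradientRG.boxAvg b j)^[n] (l.foldr (fun i g => (GradientRG.boxAvg b i)^[m] g) f)) x = v := by
        intro n
        induction n with
        | zero => intro x hx; exact ih x (by simpa using hx)
        | succ n ihn =>
          intro x hx
          rw [Function.iterate_succ_apply']
          refine boxAvg_eq_of_ball hb (ρ := l.length * (m * (b - 1)) + n * (b - 1))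
            (P := P) (fun x' hx' => ihn x' hx') x fun y hy => hx y ?_
          rw [mem_ball] at hy ⊢
          have : l.length * (m * (b - 1)) + n * (b - 1) + (b - 1) =
              l.length * (m * (b - 1)) + (n + 1) * (b - 1) := by ring
          omega
      refine hiter m x fun y hy => hx y ?_
      rw [mem_ball] at hy ⊢
      simp only [List.length_cons] at ⊢
      have : l.length * (m * (b - 1)) + m * (b - 1) = (l.length + 1) * (m * (b - 1)) := by ring
      omega
  exact key (List.finRange d) x (by simpa using hx)

/-! ## The cutoff of a set -/

/-- **The smooth cutoff of `S`**: the smoothing of the indicator of `S + [−ρ,ρ]^d`,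
`ρ = d·m·(b−1)` ([ABKM19]'s `χ_X` for `S = X^{++}`).
[cite: AdamsBuchholzKoteckyMuller2019, Lemma 7.7 (i) (7.73)] -/
def cutoff (m b : ℕ) (S : Finset (Fin d → ZMod M)) : (Fin d → ZMod M) → ℝ :=
  smooth m b fun x => if x ∈ thicken (d * (m * (b - 1))) S then 1 else 0

/-- `χ_S = 1` on `S`. [cite: AdamsBuchholzKoteckyMuller2019, Lemma 7.7 (i) (7.73)] -/
theorem cutoff_eq_one {m b : ℕ} (hb : 1 ≤ b) {S : Finset (Fin d → ZMod M)} {x : Fin d → ZMod M}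
    (hx : x ∈ S) : cutoff m b S x = 1 := by
  refine smooth_eq_of_ball hb m (P := fun y => y ∈ thicken (d * (m * (b - 1))) S)
    (fun y hy => if_pos hy) x fun y hy => ?_
  rw [mem_ball] at hy
  exact mem_thicken.2 ⟨x, hx, hy⟩

/-- `χ_S = 0` off `S + [−2ρ, 2ρ]^d`. [cite: AdamsBuchholzKoteckyMuller2019, Lemma 7.7 (i) (7.73)] -/
theorem cutoff_eq_zero {m b : ℕ} (hb : 1 ≤ b) {S : Finset (Fin d → ZMod M)} {x : Fin d → ZMod M}
    (hx : x ∉ thicken (d * (m * (b - 1)) + d * (m * (b - 1))) S) : cutoff m b S x = 0 := by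
  refine smooth_eq_of_ball hb m (P := fun y => y ∉ thicken (d * (m * (b - 1))) S)
    (fun y hy => if_neg hy) x fun y hy hyS => hx ?_
  -- `x` within `ρ` of `y ∈ S + [−ρ,ρ]^d`
  have hxy : x ∈ thicken (d * (m * (b - 1))) {y} := by
    rw [TorusPolymer.thicken_singleton, TorusPolymer.mem_ball_comm]; exact hy
  exact thicken_thicken _ _ S (TorusPolymer.thicken_mono _ (Finset.singleton_subset_iff.2 hyS) hxy)

/-- **Smoothness of the cutoff**: `|∇^γ χ_S| ≤ (2/b)^{|γ|}` for all `γ` with `γ_i ≤ m`.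
[cite: AdamsBuchholzKoteckyMuller2019, Lemma 7.7 (i) (7.73)] -/
theorem abs_iterDiff_cutoff_le {m b : ℕ} (hb : 1 ≤ b) (S : Finset (Fin d → ZMod M))
    {γ : Fin d → ℕ} (hγ : ∀ i, γ i ≤ m) (x : Fin d → ZMod M) :
    |iterDiff γ (cutoff m b S) x| ≤ (2 / (b : ℝ)) ^ (∑ i, γ i) := by
  have := abs_iterDiff_smooth_le hb (c := 1) (f := fun x => if x ∈ thicken (d * (m * (b - 1))) S then (1 : ℝ) else 0)
    (fun y => by split_ifs <;> simp) m hγ x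
  simpa [cutoff] using this

/-- `0 ≤ χ_S`. [cite: AdamsBuchholzKoteckyMuller2019, Lemma 7.7 (i) (7.73)] -/
theorem cutoff_nonneg (m b : ℕ) (S : Finset (Fin d → ZMod M)) (x : Fin d → ZMod M) :
    0 ≤ cutoff m b S x :=
  smooth_nonneg (fun _ => ite_nonneg zero_le_one le_rfl) x

/-- `χ_S ≤ 1`. [cite: AdamsBuchholzKoteckyMuller2019, Lemma 7.7 (i) (7.73)] -/
theorem cutoff_le_one {m b : ℕ} (hb : 1 ≤ b) (S : Finset (Fin d → ZMod M)) (x : Fin d → ZMod M) :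
    cutoff m b S x ≤ 1 :=
  (le_abs_self _).trans (abs_smooth_le hb (fun y => by split_ifs <;> simp) m x)

end Literature.MathematicalPhysics.StatisticalMechanics.GradientRG

end
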